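import Summits.CriticalPhenomena.PercolationContinuityZ3.Theorems.PercNearOneGluingNoHeavyQuantTwoBigTypesHH
import Summits.CriticalPhenomena.PercolationContinuityZ3.Theorems.PercNearOneGluingNoHeavyQuantTwoBigTypesHL
import Summits.CriticalPhenomena.PercolationContinuityZ3.Theorems.PercNearOneGluingNoHeavyQuantTwoBigTypesLH
import Summits.CriticalPhenomena.PercolationContinuityZ3.Theorems.PercNearOneGluingNoHeavyQuantTwoBigTypesLL
import HarnessLib

/-!
# QUANT lane R8, Conjecture DIB\* — the two-big certificate for every pair of big sizes: an INDEPENDENT second certificate family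

builds on p205010 (kernel theorem, internal audit signed; external expert review pending)

Support file (`--supports stmt-CriticalPhenomena-4575`), QUANT lane census-1 (gen 17); memo
`run/shared/lean/prim/quant/prim-quant-census-1/TWOBIG-G17.md`.  Theorems only, no definitions, no sorries, standard axioms.
T-DIB itself (`∀ x < 1, DIBStar x`) is already a kernel theorem by p1 g13's J-certificate (`Quant.IndepBlob.dibStar_holds_J`,
`…QuantTwoBigJCert`, p292639); this file completes a second, independently found and independently certified proof of the two-big
certificate (different menu policy, different polynomial reduction, different certificates), as asked for in the lane
(lead g20 V234; p1 g13 "second implementation welcome").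

* `Quant.IndepBlob.twoBigGen_ineq b₁ b₂ j` — the two-big certificate in the binder shape of lead g19's `TwoBigCertAt` (`…QuantTwoBig`)
  for a cloud of blobs of size `≤ j` (variance constraint `V ≤ j·s2`, weaker hypothesis than `TwoBigCertAt`'s `V ≤ (j/2)·s2`): PROVED for
  all `b₁, b₂, j`.  Proof: the menu items Cantelli at `ℓ₁, ℓ₂` (always), Markov on the closed mass at `ℓᵢ` when `c̃ ≤ (1+x)λᵢ`, Cantelli
  at `j` when `c̃ ≥ 1` (policy found by this seat's census), bounded by the closed forms of `…QuantTwoBigChain`, and the resulting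
  five-variable inequality certified cell by cell (`…QuantTwoBigCell*`: sixteen cells = {heavy, light}² × four policy regions, SEPARABLE
  Handelman certificates `c₁ + c₂ + c₀ = budget` found by LP on the kit and replayed by `linarith` / `linear_combination`;
  dispatch `…QuantTwoBigTypes{HH,HL,LH,LL}`, conversion `…QuantTwoBigConvert`).
* `Quant.IndepBlob.twoBigCertAt_holds : ∀ b₁ b₂ j, TwoBigCertAt b₁ b₂ j` — lead g19's F2 certificate, a fortiori; `TwoBigCert` is
  `fun b₁ b₂ j => twoBigCertAt_holds b₁ b₂ j` (in the tree as `twoBigCert_holds_of_J`), whence DIB\* as in `…QuantTwoBigJCert`.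
[this work]; the gluing rows served [cite: KozmaNitzan2024, Conjecture 3 (p. 15)]; product weights [cite: Grimmett1999, §1.3 p. 10].
-/

namespace Summit.CriticalPhenomena.PercolationContinuityZ3.Theorems

namespace Quant

open Finset

namespace IndepBlob

/-- **THE TWO-BIG CERTIFICATE** (cloud blobs of size `≤ j`: variance constraint `V ≤ j·s2`) for all big sizes `b₁, b₂` and every
layer `j`: for every admissible datum the three-way menus contain `z₁, z₂, z₀` with `x ≤ p₁p₂ + p₁(1−p₂)z₁ + (1−p₁)p₂z₂ + (1−p₁)(1−p₂)z₀`.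
[this work] -/
theorem twoBigGen_ineq (b₁ b₂ j : ℕ) :
    ∀ (x p₁ p₂ A m s2 V c : ℝ),
    1 / 2 ≤ x → x < 1 → x ^ 2 ≤ p₁ → p₁ ≤ 1 → x ^ 2 ≤ p₂ → p₂ ≤ 1 →
    j < 2 * b₁ → b₁ ≤ j → j < 2 * b₂ → b₂ ≤ j →
    (2 * j : ℝ) < (b₁ : ℝ) * (if x ≤ p₁ then p₁ else (p₁ - x ^ 2) / (1 - x))
      + (b₂ : ℝ) * (if x ≤ p₂ then p₂ else (p₂ - x ^ 2) / (1 - x)) + c →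
    c ≤ m → x ^ 2 * A + (1 - x) * c ≤ m → m ≤ A →
    0 ≤ V → 0 ≤ s2 → s2 ≤ (1 - x) * (2 * m - c) → s2 ≤ m → s2 ≤ A - m →
    V ≤ (j : ℝ) * s2 →
    ∃ z₁ z₂ z₀ : ℝ,
      (z₁ ≤ 0 ∨ (((j - b₁ : ℕ) : ℝ) < A ∧ z₁ ≤ 1 - (A - m) / (A - ((j - b₁ : ℕ) : ℝ)))
        ∨ (((j - b₁ : ℕ) : ℝ) < m ∧ z₁ ≤ 1 - V / (V + (m - ((j - b₁ : ℕ) : ℝ)) ^ 2))) ∧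
      (z₂ ≤ 0 ∨ (((j - b₂ : ℕ) : ℝ) < A ∧ z₂ ≤ 1 - (A - m) / (A - ((j - b₂ : ℕ) : ℝ)))
        ∨ (((j - b₂ : ℕ) : ℝ) < m ∧ z₂ ≤ 1 - V / (V + (m - ((j - b₂ : ℕ) : ℝ)) ^ 2))) ∧
      (z₀ ≤ 0 ∨ ((j : ℝ) < A ∧ z₀ ≤ 1 - (A - m) / (A - j)) ∨ ((j : ℝ) < m ∧ z₀ ≤ 1 - V / (V + (m - j) ^ 2))) ∧
      x ≤ p₁ * p₂ + p₁ * (1 - p₂) * z₁ + (1 - p₁) * p₂ * z₂ + (1 - p₁) * (1 - p₂) * z₀ := by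
  intro x p₁ p₂ A m s2 V c hx hx1 hxp1 hp11 hxp2 hp21 hjb1 hb1j hjb2 hb2j hcred hcm hclosed hmA hV0 _hs20 hs2c _hs2m _hs2A hVs2
  have hx0 : 0 < x := by linarith
  have hy0 : 0 < 1 - x := by linarith
  have hb1 : 1 ≤ b₁ := by omega
  have hj1 : 1 ≤ j := le_trans hb1 hb1j
  have hJ : (0 : ℝ) < (j : ℝ) := by exact_mod_cast hj1
  have hJB1 : (j : ℝ) < 2 * (b₁ : ℝ) := by exact_mod_cast hjb1
  have hB1J : (b₁ : ℝ) ≤ (j : ℝ) := by exact_mod_cast hb1j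
  have hJB2 : (j : ℝ) < 2 * (b₂ : ℝ) := by exact_mod_cast hjb2
  have hB2J : (b₂ : ℝ) ≤ (j : ℝ) := by exact_mod_cast hb2j
  have hL1 : ((j - b₁ : ℕ) : ℝ) = (j : ℝ) - (b₁ : ℝ) := Nat.cast_sub hb1j
  have hL2 : ((j - b₂ : ℕ) : ℝ) = (j : ℝ) - (b₂ : ℝ) := Nat.cast_sub hb2j
  rw [hL1, hL2]
  -- the two bigs' coordinates
  obtain ⟨hφ10, hφ11, hu1, hv1, ha1, hbb1, hH1, hLt1⟩ := tbc_big_coords x p₁ (j : ℝ) (b₁ : ℝ) hx hx1 hxp1 hp11 hJ hJB1 hB1J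
  obtain ⟨hφ20, hφ21, hu2, hv2, ha2, hbb2, hH2, hLt2⟩ := tbc_big_coords x p₂ (j : ℝ) (b₂ : ℝ) hx hx1 hxp2 hp21 hJ hJB2 hB2J
  set φ₁ : ℝ := (if x ≤ p₁ then p₁ else (p₁ - x ^ 2) / (1 - x)) with hφ₁
  set φ₂ : ℝ := (if x ≤ p₂ then p₂ else (p₂ - x ^ 2) / (1 - x)) with hφ₂
  set J : ℝ := (j : ℝ) with hJdef
  set B₁ : ℝ := (b₁ : ℝ) with hB₁
  set B₂ : ℝ := (b₂ : ℝ) with hB₂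
  set u₁ : ℝ := B₁ * φ₁ / J with hu₁
  set v₁ : ℝ := (B₁ - B₁ * φ₁) / J with hv₁
  set u₂ : ℝ := B₂ * φ₂ / J with hu₂
  set v₂ : ℝ := (B₂ - B₂ * φ₂) / J with hv₂
  -- the infimum of the cloud credit and its coordinates
  set cs : ℝ := 2 * J - B₁ * φ₁ - B₂ * φ₂ with hcsdef
  have hcs_u : cs = J * (2 - u₁ - u₂) := by
    rw [hcsdef, hu₁, hu₂, mul_sub, mul_sub, mul_div_cancel₀ _ hJ.ne', mul_div_cancel₀ _ hJ.ne']; ring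
  have hw1 : cs - (J - B₁) = J * (1 + v₁ - u₂) := by
    rw [hcsdef, hv₁, hu₂, mul_sub, mul_add, mul_div_cancel₀ _ hJ.ne', mul_div_cancel₀ _ hJ.ne']; ring
  have hw2 : cs - (J - B₂) = J * (1 + v₂ - u₁) := by
    rw [hcsdef, hv₂, hu₁, mul_sub, mul_add, mul_div_cancel₀ _ hJ.ne', mul_div_cancel₀ _ hJ.ne']; ring
  have hw0 : cs - J = J * (1 - u₁ - u₂) := by
    rw [hcsdef, hu₁, hu₂, mul_sub, mul_sub, mul_div_cancel₀ _ hJ.ne', mul_div_cancel₀ _ hJ.ne']; ring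
  have hl1 : J - B₁ = J * (1 - u₁ - v₁) := by
    rw [hu₁, hv₁, mul_sub, mul_sub, mul_div_cancel₀ _ hJ.ne', mul_div_cancel₀ _ hJ.ne']; ring
  have hl2 : J - B₂ = J * (1 - u₂ - v₂) := by
    rw [hu₂, hv₂, mul_sub, mul_sub, mul_div_cancel₀ _ hJ.ne', mul_div_cancel₀ _ hJ.ne']; ring
  have hcsc : cs < c := by rw [hcsdef]; linarith
  have hcsm : cs < m := lt_of_lt_of_le hcsc hcm
  have hu1le : u₁ ≤ 1 := by linarith
  have hu2le : u₂ ≤ 1 := by linarith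
  -- degenerate case: both bigs sure and of full size
  by_cases hct : (2 - u₁ - u₂ : ℝ) ≤ 0
  · have hu1e : u₁ = 1 := by linarith
    have hu2e : u₂ = 1 := by linarith
    have hB1 : 0 < B₁ := by linarith
    have hB2 : 0 < B₂ := by linarith
    have hp1e : p₁ = 1 := by
      have h1 : B₁ * φ₁ = J := by
        have := hu1e; rw [hu₁, div_eq_one_iff_eq hJ.ne'] at this; exact this
      have : B₁ * 1 ≤ B₁ * φ₁ := by rw [h1, mul_one]; exact hB1J
      have hφ : 1 ≤ φ₁ := le_of_mul_le_mul_left this hB1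
      linarith [phi_le_gate x p₁ hx0.le hx1]
    have hp2e : p₂ = 1 := by
      have h1 : B₂ * φ₂ = J := by
        have := hu2e; rw [hu₂, div_eq_one_iff_eq hJ.ne'] at this; exact this
      have : B₂ * 1 ≤ B₂ * φ₂ := by rw [h1, mul_one]; exact hB2J
      have hφ : 1 ≤ φ₂ := le_of_mul_le_mul_left this hB2
      linarith [phi_le_gate x p₂ hx0.le hx1]
    refine ⟨0, 0, 0, Or.inl le_rfl, Or.inl le_rfl, Or.inl le_rfl, ?_⟩
    rw [hp1e, hp2e]; linarith
  have hct' : (0 : ℝ) < 2 - u₁ - u₂ := lt_of_not_ge hct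
  have hcs0 : 0 < cs := by rw [hcs_u]; exact mul_pos hJ hct'
  -- the cloud bounds
  have hk0 : (0 : ℝ) ≤ J * (1 - x) := mul_nonneg hJ.le hy0.le
  have hVle : V ≤ J * (1 - x) * (2 * m - cs) := by
    have h1 : V ≤ J * ((1 - x) * (2 * m - c)) := hVs2.trans (mul_le_mul_of_nonneg_left hs2c hJ.le)
    have h2 : J * (1 - x) * (2 * m - c) ≤ J * (1 - x) * (2 * m - cs) := mul_le_mul_of_nonneg_left (by linarith) hk0
    linarith
  have hAcl : x ^ 2 * A ≤ m - (1 - x) * cs := by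
    have h2 : (1 - x) * cs ≤ (1 - x) * c := mul_le_mul_of_nonneg_left hcsc.le hy0.le
    linarith
  have hw1nn : 0 ≤ 1 + v₁ - u₂ := by linarith
  have hw2nn : 0 ≤ 1 + v₂ - u₁ := by linarith
  have hL1cs : J - B₁ ≤ cs := by have := mul_nonneg hJ.le hw1nn; linarith [hw1]
  have hL2cs : J - B₂ ≤ cs := by have := mul_nonneg hJ.le hw2nn; linarith [hw2]
  have hL1m : J - B₁ < m := lt_of_le_of_lt hL1cs hcsm
  have hL2m : J - B₂ < m := lt_of_le_of_lt hL2cs hcsm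
  have hL1A : J - B₁ < A := lt_of_lt_of_le hL1m hmA
  have hL2A : J - B₂ < A := lt_of_lt_of_le hL2m hmA
  have hL10 : 0 ≤ J - B₁ := by linarith
  have hL20 : 0 ≤ J - B₂ := by linarith
  -- the items in closed form (product form)
  have hD1 := tbc_D_pos x (2 - u₁ - u₂) (1 + v₁ - u₂) hx1 hct'
  have hD2 := tbc_D_pos x (2 - u₁ - u₂) (1 + v₂ - u₁) hx1 hct'
  have hD0 := tbc_D_pos x (2 - u₁ - u₂) (1 - u₁ - u₂) hx1 hct'
  have hC1 : (1 + v₁ - u₂) ^ 2 ≤ (1 - V / (V + (m - (J - B₁)) ^ 2)) * ((1 - x) * (2 - u₁ - u₂) + (1 + v₁ - u₂) ^ 2) :=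
    tbc_item_prod _ _ _ hD1 (tbc_cantelli_closed x (2 - u₁ - u₂) (1 + v₁ - u₂) V J (J - B₁) cs m hJ hx1 hcs_u hw1 hct' hV0 hVle
      hL10 hL1cs hcsm.le hL1m)
  have hC2 : (1 + v₂ - u₁) ^ 2 ≤ (1 - V / (V + (m - (J - B₂)) ^ 2)) * ((1 - x) * (2 - u₁ - u₂) + (1 + v₂ - u₁) ^ 2) :=
    tbc_item_prod _ _ _ hD2 (tbc_cantelli_closed x (2 - u₁ - u₂) (1 + v₂ - u₁) V J (J - B₂) cs m hJ hx1 hcs_u hw2 hct' hV0 hVle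
      hL20 hL2cs hcsm.le hL2m)
  have hC0 : 0 ≤ (2 - u₁ - u₂) - 1 →
      (1 - u₁ - u₂) ^ 2 ≤ (1 - V / (V + (m - J) ^ 2)) * ((1 - x) * (2 - u₁ - u₂) + (1 - u₁ - u₂) ^ 2) := by
    intro hc
    have hJcs : J ≤ cs := by have := mul_nonneg hJ.le hc; linarith [hcs_u]
    have hJm : J < m := lt_of_le_of_lt hJcs hcsm
    exact tbc_item_prod _ _ _ hD0 (tbc_cantelli_closed x (2 - u₁ - u₂) (1 - u₁ - u₂) V J J cs m hJ hx1 hcs_u hw0 hct' hV0 hVle hJ.le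
      hJcs hcsm.le hJm)
  have hM1 : 0 ≤ (2 - (1 - x)) * (1 - u₁ - v₁) - (2 - u₁ - u₂) →
      (1 - (1 - x)) * (1 + v₁ - u₂) ≤ (1 - (A - m) / (A - (J - B₁))) * ((2 - u₁ - u₂) - (1 - (1 - x)) * (1 - u₁ - v₁)) := by
    intro hr
    rw [sub_sub_cancel]
    have hreg : 2 - u₁ - u₂ ≤ (1 + x) * (1 - u₁ - v₁) := by linarith
    have hden : 0 < (2 - u₁ - u₂) - x * (1 - u₁ - v₁) := by
      have h1 := mul_pos hy0 hct'; have h2 := mul_nonneg hx0.le hw1nn; linarith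
    exact tbc_item_prod _ _ _ hden (tbc_markov_closed x (2 - u₁ - u₂) (1 - u₁ - v₁) (1 + v₁ - u₂) A J (J - B₁) cs m hJ hx hx1
      hcs_u hl1 hw1 hct' hw1nn hreg hcsm.le hAcl hL1A)
  have hM2 : 0 ≤ (2 - (1 - x)) * (1 - u₂ - v₂) - (2 - u₁ - u₂) →
      (1 - (1 - x)) * (1 + v₂ - u₁) ≤ (1 - (A - m) / (A - (J - B₂))) * ((2 - u₁ - u₂) - (1 - (1 - x)) * (1 - u₂ - v₂)) := by
    intro hr
    rw [sub_sub_cancel]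
    have hreg : 2 - u₁ - u₂ ≤ (1 + x) * (1 - u₂ - v₂) := by linarith
    have hden : 0 < (2 - u₁ - u₂) - x * (1 - u₂ - v₂) := by
      have h1 := mul_pos hy0 hct'; have h2 := mul_nonneg hx0.le hw2nn; linarith
    exact tbc_item_prod _ _ _ hden (tbc_markov_closed x (2 - u₁ - u₂) (1 - u₂ - v₂) (1 + v₂ - u₁) A J (J - B₂) cs m hJ hx hx1
      hcs_u hl2 hw2 hct' hw2nn hreg hcsm.le hAcl hL2A)
  -- menu memberships of the candidate items
  have memC1 : J - B₁ < m ∧ 1 - V / (V + (m - (J - B₁)) ^ 2) ≤ 1 - V / (V + (m - (J - B₁)) ^ 2) := ⟨hL1m, le_rfl⟩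
  have memC2 : J - B₂ < m ∧ 1 - V / (V + (m - (J - B₂)) ^ 2) ≤ 1 - V / (V + (m - (J - B₂)) ^ 2) := ⟨hL2m, le_rfl⟩
  have memM1 : J - B₁ < A ∧ 1 - (A - m) / (A - (J - B₁)) ≤ 1 - (A - m) / (A - (J - B₁)) := ⟨hL1A, le_rfl⟩
  have memM2 : J - B₂ < A ∧ 1 - (A - m) / (A - (J - B₂)) ≤ 1 - (A - m) / (A - (J - B₂)) := ⟨hL2A, le_rfl⟩
  have hxy : (1 : ℝ) - (1 - x) = x := sub_sub_cancel 1 x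
  have hhy : 1 - x ≤ 1 / 2 := by linarith
  -- dispatch on the types; the four-way disjunction picks the cell
  have finish : ∀ zC₁ zM₁ zC₂ zM₂ : ℝ,
      (J - B₁ < m ∧ zC₁ ≤ 1 - V / (V + (m - (J - B₁)) ^ 2)) → (J - B₂ < m ∧ zC₂ ≤ 1 - V / (V + (m - (J - B₂)) ^ 2)) →
      (J - B₁ < A ∧ zM₁ ≤ 1 - (A - m) / (A - (J - B₁))) → (J - B₂ < A ∧ zM₂ ≤ 1 - (A - m) / (A - (J - B₂))) →
      ((0 ≤ (2 - u₁ - u₂) - 1 ∧ 1 - (1 - x) ≤ p₁ * p₂ + p₁ * (1 - p₂) * zC₁ + (1 - p₁) * p₂ * zC₂ +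
          (1 - p₁) * (1 - p₂) * (1 - V / (V + (m - J) ^ 2))) ∨
        (1 - (1 - x) ≤ p₁ * p₂ + p₁ * (1 - p₂) * zC₁ + (1 - p₁) * p₂ * zC₂ + (1 - p₁) * (1 - p₂) * 0) ∨
        (1 - (1 - x) ≤ p₁ * p₂ + p₁ * (1 - p₂) * zM₁ + (1 - p₁) * p₂ * zC₂ + (1 - p₁) * (1 - p₂) * 0) ∨
        (1 - (1 - x) ≤ p₁ * p₂ + p₁ * (1 - p₂) * zC₁ + (1 - p₁) * p₂ * zM₂ + (1 - p₁) * (1 - p₂) * 0)) →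
      ∃ z₁ z₂ z₀ : ℝ,
      (z₁ ≤ 0 ∨ (J - B₁ < A ∧ z₁ ≤ 1 - (A - m) / (A - (J - B₁))) ∨ (J - B₁ < m ∧ z₁ ≤ 1 - V / (V + (m - (J - B₁)) ^ 2))) ∧
      (z₂ ≤ 0 ∨ (J - B₂ < A ∧ z₂ ≤ 1 - (A - m) / (A - (J - B₂))) ∨ (J - B₂ < m ∧ z₂ ≤ 1 - V / (V + (m - (J - B₂)) ^ 2))) ∧
      (z₀ ≤ 0 ∨ (J < A ∧ z₀ ≤ 1 - (A - m) / (A - J)) ∨ (J < m ∧ z₀ ≤ 1 - V / (V + (m - J) ^ 2))) ∧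
      x ≤ p₁ * p₂ + p₁ * (1 - p₂) * z₁ + (1 - p₁) * p₂ * z₂ + (1 - p₁) * (1 - p₂) * z₀ := by
    intro zC₁ zM₁ zC₂ zM₂ mC1 mC2 mM1 mM2 h
    rw [hxy] at h
    rcases h with ⟨hc, h⟩ | h | h | h
    · have hJcs : J ≤ cs := by have := mul_nonneg hJ.le hc; linarith [hcs_u]
      have hJm : J < m := lt_of_le_of_lt hJcs hcsm
      exact ⟨zC₁, zC₂, _, Or.inr (Or.inr mC1), Or.inr (Or.inr mC2), Or.inr (Or.inr ⟨hJm, le_rfl⟩), h⟩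
    · exact ⟨zC₁, zC₂, 0, Or.inr (Or.inr mC1), Or.inr (Or.inr mC2), Or.inl le_rfl, h⟩
    · exact ⟨zM₁, zC₂, 0, Or.inr (Or.inl mM1), Or.inr (Or.inr mC2), Or.inl le_rfl, h⟩
    · exact ⟨zC₁, zM₂, 0, Or.inr (Or.inr mC1), Or.inr (Or.inl mM2), Or.inl le_rfl, h⟩
  by_cases ht1 : x ≤ p₁
  · obtain ⟨hP1, hhv1⟩ := hH1 ht1
    by_cases ht2 : x ≤ p₂
    · obtain ⟨hP2, hhv2⟩ := hH2 ht2
      exact finish _ _ _ _ memC1 memC2 memM1 memM2 (tbcType_HH (1 - x) u₁ v₁ u₂ v₂ p₁ p₂ _ _ _ _ _ hy0 hhy hu1 hv1 hu2 hv2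
        ha1 hbb1 ha2 hbb2 (by rw [hxy]; exact hhv1) (by rw [hxy]; exact hhv2) hct' hP1 hP2 hC1 hC2 hM1 hM2 hC0)
    · obtain ⟨hP2, hlt2, _⟩ := hLt2 ht2
      exact finish _ _ _ _ memC1 memC2 memM1 memM2 (tbcType_HL (1 - x) u₁ v₁ u₂ v₂ p₁ p₂ _ _ _ _ _ hy0 hhy hu1 hv1 hu2 hv2
        ha1 hbb1 ha2 hbb2 (by rw [hxy]; exact hhv1) (by rw [hxy]; exact hlt2) hct' hP1 (by rw [hxy]; exact hP2) hC1 hC2 hM1 hM2 hC0)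
  · obtain ⟨hP1, hlt1, _⟩ := hLt1 ht1
    by_cases ht2 : x ≤ p₂
    · obtain ⟨hP2, hhv2⟩ := hH2 ht2
      exact finish _ _ _ _ memC1 memC2 memM1 memM2 (tbcType_LH (1 - x) u₁ v₁ u₂ v₂ p₁ p₂ _ _ _ _ _ hy0 hhy hu1 hv1 hu2 hv2
        ha1 hbb1 ha2 hbb2 (by rw [hxy]; exact hlt1) (by rw [hxy]; exact hhv2) hct' (by rw [hxy]; exact hP1) hP2 hC1 hC2 hM1 hM2 hC0)
    · obtain ⟨hP2, hlt2, _⟩ := hLt2 ht2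
      exact finish _ _ _ _ memC1 memC2 memM1 memM2 (tbcType_LL (1 - x) u₁ v₁ u₂ v₂ p₁ p₂ _ _ _ _ _ hy0 hhy hu1 hv1 hu2 hv2
        ha1 hbb1 ha2 hbb2 (by rw [hxy]; exact hlt1) (by rw [hxy]; exact hlt2) hct' (by rw [hxy]; exact hP1) (by rw [hxy]; exact hP2)
        hC1 hC2 hM1 hM2 hC0)

/-- **Lead g19's F2 certificate `TwoBigCertAt b₁ b₂ j` holds for all `b₁ b₂ j`** (a fortiori: its cloud constraint `V ≤ (j/2)·s2`
implies `V ≤ j·s2`). [this work] -/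
theorem twoBigCertAt_holds (b₁ b₂ j : ℕ) : TwoBigCertAt b₁ b₂ j := by
  intro x p₁ p₂ A m s2 V c hx hx1 hxp1 hp11 hxp2 hp21 hjb1 hb1j hjb2 hb2j hcred hcm hclosed hmA hV0 hs20 hs2c hs2m hs2A hVs2
  have hVs2' : V ≤ (j : ℝ) * s2 := hVs2.trans (by nlinarith [(Nat.cast_nonneg j : (0:ℝ) ≤ j)])
  exact twoBigGen_ineq b₁ b₂ j x p₁ p₂ A m s2 V c hx hx1 hxp1 hp11 hxp2 hp21 hjb1 hb1j hjb2 hb2j hcred hcm hclosed hmA hV0 hs20 hs2c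
    hs2m hs2A hVs2'

end IndepBlob

end Quant

end Summit.CriticalPhenomena.PercolationContinuityZ3.Theorems
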